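import Literature.NumberTheory.Automorphic.TwistedCentralEigensystem
import Literature.NumberTheory.Automorphic.ResGLnCohomology
import HarnessLib

/-!
# The central Hecke eigensystem in the cohomology of `Res_{K/ℚ} GL₂` is an algebraic Größencharakter

Topic `NumberTheory/Automorphic`; namespace `Literature.NumberTheory.Automorphic`, grouping
sub-namespace `ResGLnCohomology` (the receptacle
`levelCohomology k n K 𝔫 λ q = H^q(GL_n(K)⁺, Fun(GL_n(𝔸_K^∞)/K_f(𝔫), E_λ(k)))` of `ResGLnCohomology`).
A *proofs* file (one abbreviation with body and theorems; no named fact, no instance, no `sorry`)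
under the named fact `ResGLnCohomology.Harder1987_eigensystem_cuspidalOrEisenstein`
(`ResGL2EigensystemCuspidalOrEisenstein`): the CENTRAL part of the Eisenstein half of its printed
proof [Harder1987, §2] — the eigenvalues `a_{w,2}` of `T_{w,2} = T_{ϖ_w·1}` on a non-zero class of
`H^q(S_{K_f(𝔫)}, Ẽ_λ)` (equivalently the system `ζ` of the factorisation
`a_{w,1} = N(w) ζ_w μ_w⁻¹ + μ_w`, `a_{w,2} = ζ_w` of `ResGL2BorelEigenvalueFactorisation`) form an
algebraic Größencharakter, for `GL₂` over ANY number field `K` and ANY weight `λ`: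

* `ResGLnCohomology.centralWeight k n K λ a = ∏_{τ : K → k} (τ(a)ⁿ)^{lowest λ_τ} τ(a)^{deg λ_τ}` —
  the central character of `E_λ = ⊗_τ V_{λ_τ}` (`coeffRep_scalar`: the scalar `a · 1 ∈ GL_n(K)`
  acts on `E_λ(k)` by `ω_λ(a)`, factorwise `GLnCohomology.coeffRepGL_scalar`); for `n = 2` and
  dominant `λ_τ` the exponent of `τ(a)` is `λ_{τ,0} + λ_{τ,1}`;
* `scalar_mem_glTotPos_two`, `zScalar`: `a · 1 ∈ Z(GL₂(K)⁺)` (`det = a²` is totally positive),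
  with diagonal image the principal scalar idele and acting on `E_λ` by `ω_λ(a)`; hence
  `heckeOp_globalScalar`: **`T_{a·1} = ω_λ(a)` on `H^q(S_{K_f(𝔫)}, Ẽ_λ)`**
  (`TwistedQuotient.heckeEnd_apply_of_mem_center`);
* `map_centralWeight`: through `ι : E ≃+* ℂ`,
  `ι(ω_λ(a)) = ∏_{w ∣ ∞} w(a)^{p_w} conj(w(a))^{q_w}` with `p_w = M(λ_{σ_w})`,
  `q_w = (mult w − 1) M(λ_{σ̄_w})`, `M(μ) = n · lowest(μ) + deg(μ)` (`centralExponentAt`), the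
  embeddings `K → E` being matched with `K → ℂ` along `ι` (`ParallelWeight.embEquiv`);
* `isGrossencharakter_centralEigensystem` — for `ξ ≠ 0` in `levelCohomology E 2 K 𝔫 λ q` with
  `T_{w,2} ξ = a(w) ξ` off a finite `S`: **`w ↦ ι(a(w))` is a Größencharakter modulo `𝔫 ∏_{w ∈ S} w`
  of infinity type `(p, q)`** (`TwistedQuotient.isGrossencharakter_centralEigensystem_of_types`).

## References

* G. Harder, *Eisenstein cohomology of arithmetic groups. The case GL₂*, Invent. Math. 89 (1987), §2
  [Harder1987].
* J. Neukirch, *Algebraic Number Theory* (1999), Ch. VII §6 [NeukirchANT1999].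
-/

noncomputable section

open scoped NumberField ComplexConjugate TensorProduct
open IsDedekindDomain NumberField

namespace Literature.NumberTheory.Automorphic

namespace ResGLnCohomology

open BigHeckeGLn ParallelWeight Literature.NumberTheory.GaloisRepresentations

/-! ### The central character `ω_λ` of `E_λ` -/

section Scalar

variable (k : Type) [Field k] [CharZero k] (n : ℕ) (K : Type) [Field K] [NumberField K]

/-- **The central character `ω_λ(a) = ∏_{τ : K → k} (τ(a)ⁿ)^{lowest λ_τ} · τ(a)^{deg λ_τ}`** of the
coefficient module `E_λ(k) = ⊗_τ V_{λ_τ}(k)` at `a ∈ K^×` (`V_μ = S_{μ−μ_{n−1}} ⊗ det^{μ_{n−1}}`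
has central character `t ↦ (tⁿ)^{μ_{n−1}} t^{|μ−μ_{n−1}|}`). [cite: Harder1987, §2] -/
abbrev centralWeight (lam : (K →+* k) → Fin n → ℤ) (a : Kˣ) : k :=
  ∏ τ : K →+* k, ((((Units.map (τ : K →* k) a) ^ n) ^ GLnCohomology.lowestEntry (lam τ) : kˣ) : k) *
    (τ a) ^ GLnCohomology.coeffDegree (lam τ)

/-- **The scalar `a · 1 ∈ GL_n(K)` acts on `E_λ(k)` by `ω_λ(a)`** (factorwise
`GLnCohomology.coeffRepGL_scalar` through the embeddings `τ`, multilinearity of `⊗`).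
[cite: Harder1987, §2] -/
theorem coeffRep_scalar (lam : (K →+* k) → Fin n → ℤ) (a : Kˣ) (v : CoeffModule k n K lam) :
    coeffRep k n K lam (Matrix.GeneralLinearGroup.scalar (Fin n) a) v = centralWeight k n K lam a • v := by
  -- the statement on the tensor product underlying `CoeffModule k n K lam`
  have key : ∀ x : ⨂[k] τ : (K →+* k), GLnCohomology.CoeffModule k n (lam τ),
      PiTensorProduct.map (R := k) (fun τ : K →+* k =>
        ((GLnCohomology.coeffRepGL k n (lam τ)
            (Matrix.GeneralLinearGroup.map (τ : K →+* k) (Matrix.GeneralLinearGroup.scalar (Fin n) a)) :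
          GLnCohomology.CoeffModule k n (lam τ) →ₗ[k] GLnCohomology.CoeffModule k n (lam τ)))) x =
        (∏ τ : K →+* k, ((((Units.map (τ : K →* k) a) ^ n) ^ GLnCohomology.lowestEntry (lam τ) : kˣ) : k) *
          (τ a) ^ GLnCohomology.coeffDegree (lam τ)) • x := by
    intro x
    induction x using PiTensorProduct.induction_on with
    | smul_tprod r v =>
      rw [map_smul, PiTensorProduct.map_tprod]
      simp_rw [coeffRepGL_map_scalar]
      rw [MultilinearMap.map_smul_univ, smul_comm]
    | add x y hx hy => rw [map_add, hx, hy, smul_add]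
  exact key v

omit [NumberField K] in
/-- `det (a · 1) = a²` is totally positive: **`a · 1 ∈ GL₂(K)⁺`** for every `a ∈ K^×`. [folklore] -/
theorem scalar_mem_glTotPos_two (a : Kˣ) : Matrix.GeneralLinearGroup.scalar (Fin 2) a ∈ glTotPos 2 K := by
  rw [mem_glTotPos_iff]
  intro τ
  rw [Matrix.GeneralLinearGroup.det_scalar, Fintype.card_fin, Units.val_pow_eq_pow_val, map_pow]
  have h : τ (a : K) ≠ 0 := (map_ne_zero τ).2 a.ne_zero
  exact lt_of_le_of_ne (sq_nonneg _) (pow_ne_zero 2 h).symm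

variable {K} in
omit [NumberField K] in
/-- The central element `a · 1` of `GL₂(K)⁺`. [folklore] -/
abbrev zScalar (a : Kˣ) : glTotPos 2 K :=
  ⟨Matrix.GeneralLinearGroup.scalar (Fin 2) a, scalar_mem_glTotPos_two K a⟩

variable {K} in
omit [NumberField K] in
/-- `a · 1` is central in `GL₂(K)⁺`. [folklore] -/
theorem zScalar_mem_center (a : Kˣ) : zScalar a ∈ Subgroup.center (glTotPos 2 K) :=
  Subgroup.mem_center_iff.2 fun g => Subtype.ext (by
    change (g : GL (Fin 2) K) * Matrix.GeneralLinearGroup.scalar (Fin 2) a =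
      Matrix.GeneralLinearGroup.scalar (Fin 2) a * (g : GL (Fin 2) K)
    exact Subgroup.mem_center_iff.1 (glScalar_mem_center a) (g : GL (Fin 2) K))

variable {K} in
/-- The diagonal image of `a · 1 ∈ GL₂(K)⁺` is the principal scalar idele `a · 1`. [folklore] -/
theorem diagPos_zScalar (a : Kˣ) :
    diagPos 2 K (zScalar a) = globalEmbedding 2 K (Matrix.GeneralLinearGroup.scalar (Fin 2) a) :=
  rfl

variable {K} in
/-- `a · 1 ∈ GL₂(K)⁺` acts on `E_λ(k)` by `ω_λ(a)`. [cite: Harder1987, §2] -/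
theorem coeffRepPos_zScalar (lam : (K →+* k) → Fin 2 → ℤ) (a : Kˣ) (v : CoeffModule k 2 K lam) :
    coeffRepPos k 2 K lam (zScalar a) v = centralWeight k 2 K lam a • v :=
  coeffRep_scalar k 2 K lam a v

end Scalar

/-! ### Global scalars act on `H^q(S_{K_f(𝔫)}, Ẽ_λ)` through `ω_λ` -/

section Global

variable (k : Type) [Field k] [CharZero k] (K : Type) [Field K] [NumberField K]

/-- **`T_{a·1} = ω_λ(a)` on `H^q(S_{K_f(𝔫)}, Ẽ_λ(k))`** for `a ∈ K^×`: global central elements act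
on `H^q(GL₂(K)⁺, ·)` through the central character of the coefficients
(`TwistedQuotient.heckeEnd_apply_of_mem_center`). [cite: Harder1987, §2] -/
theorem heckeOp_globalScalar (𝔫 : Ideal (𝓞 K)) (lam : (K →+* k) → Fin 2 → ℤ) (q : ℕ) (a : Kˣ)
    (x : levelCohomology k 2 K 𝔫 lam q) :
    heckeOp k 2 K 𝔫 lam q (globalEmbedding 2 K (Matrix.GeneralLinearGroup.scalar (Fin 2) a)) x =
      centralWeight k 2 K lam a • x :=
  TwistedQuotient.heckeEnd_apply_of_mem_center (V := CoeffModule k 2 K lam) (diagPos 2 K)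
    (level 2 K 𝔫) (coeffRepPos k 2 K lam) (zScalar_mem_center a)
    (by rw [diagPos_zScalar]; exact globalEmbedding_scalar_mem_center a) (coeffRepPos_zScalar k lam a) q x

end Global

/-! ### Transport through `ι : E ≃+* ℂ` and the Größencharakter -/

section Complex

variable {E : Type} [Field E] {K : Type} [Field K] [NumberField K] {n : ℕ}

/-- The exponent `M(λ, σ) = n · lowest(λ_τ) + deg(λ_τ)` of `σ(a)` in `ι(ω_λ(a))`, `τ = ι⁻¹ ∘ σ` the
embedding `K → E` matched with `σ : K → ℂ`. [folklore] -/
abbrev centralExponentAt (ι : E ≃+* ℂ) (lam : (K →+* E) → Fin n → ℤ) (σ : K →+* ℂ) : ℤ :=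
  (n : ℤ) * GLnCohomology.lowestEntry (lam (ι.symm.toRingHom.comp σ)) +
    GLnCohomology.coeffDegree (lam (ι.symm.toRingHom.comp σ))

/-- `ι(ω_λ(a)) = ∏_{σ : K → ℂ} σ(a)^{M(λ, σ)}`. [folklore] -/
theorem map_centralWeight_eq_prod_embeddings [CharZero E] (ι : E ≃+* ℂ)
    (lam : (K →+* E) → Fin n → ℤ) (a : Kˣ) :
    ι (centralWeight E n K lam a) = ∏ σ : K →+* ℂ, σ (a : K) ^ centralExponentAt ι lam σ := by
  rw [centralWeight, map_prod]
  refine Fintype.prod_equiv (embEquiv ι) _ _ fun τ => ?_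
  have hτ : (embEquiv (F := K) ι τ) (a : K) = ι (τ a) := rfl
  have hτ' : ι.symm.toRingHom.comp (embEquiv (F := K) ι τ) = τ := by
    ext x
    change ι.symm (ι (τ x)) = τ x
    rw [RingEquiv.symm_apply_apply]
  have h0 : ι (τ (a : K)) ≠ 0 := by
    rw [map_ne_zero, map_ne_zero]; exact a.ne_zero
  rw [hτ, centralExponentAt, hτ', map_mul, map_pow, zpow_add₀ h0, zpow_mul, zpow_natCast, zpow_natCast]
  congr 1
  rw [Units.val_zpow_eq_zpow_val, map_zpow₀, Units.val_pow_eq_pow_val, map_pow, Units.coe_map,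
    MonoidHom.coe_coe]

/-- **`ι(ω_λ(a)) = ∏_{w ∣ ∞} w(a)^{p_w} · conj(w(a))^{q_w}`** with `p_w = M(λ, σ_w)` and
`q_w = (mult w − 1) · M(λ, σ̄_w)` (fibrewise over the infinite places; at a real place `q_w = 0`).
[folklore] -/
theorem map_centralWeight [CharZero E] (ι : E ≃+* ℂ) (lam : (K →+* E) → Fin n → ℤ) (a : Kˣ) :
    ι (centralWeight E n K lam a) =
      ∏ w : InfinitePlace K, w.embedding (a : K) ^ centralExponentAt ι lam w.embedding *
        conj (w.embedding (a : K)) ^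
          (((w.mult - 1 : ℕ) : ℤ) * centralExponentAt ι lam (ComplexEmbedding.conjugate w.embedding)) := by
  rw [map_centralWeight_eq_prod_embeddings,
    prod_embeddings_eq_prod_infinitePlace (fun σ : K →+* ℂ => σ (a : K) ^ centralExponentAt ι lam σ)]
  refine Finset.prod_congr rfl fun w _ => ?_
  rw [mul_comm (((w.mult - 1 : ℕ) : ℤ)), zpow_mul, zpow_natCast]
  rfl

/-- **The central eigensystem in `H^q(S_{K_f(𝔫)}, Ẽ_λ)` is an algebraic Größencharakter.**  For a
field `E` with `ι : E ≃+* ℂ`, `𝔫 ≠ 0`, a finite set `S` of places and a NON-ZERO class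
`ξ ∈ levelCohomology E 2 K 𝔫 λ q` with `T_{w,2} ξ = a(w) ξ` for all `w ∉ S`: the function
`w ↦ ι(a(w))` is a Größencharakter modulo `𝔫 ∏_{w ∈ S} w` of infinity type
`(p_w, q_w) = (M(λ, σ_w), (mult w − 1) M(λ, σ̄_w))`, i.e. that of the central character `ω_λ`.
[cite: Harder1987, §2] [cite: NeukirchANT1999, Ch. VII §6 Def. (6.1)] -/
theorem isGrossencharakter_centralEigensystem (ι : E ≃+* ℂ) {𝔫 : Ideal (𝓞 K)} (h𝔫 : 𝔫 ≠ 0)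
    {lam : (K →+* E) → Fin 2 → ℤ} {q : ℕ} {S : Set (HeightOneSpectrum (𝓞 K))} (hS : S.Finite)
    {ξ : levelCohomology E 2 K 𝔫 lam q} (hξ : ξ ≠ 0) (a : HeightOneSpectrum (𝓞 K) → E)
    (heig : ∀ w, w ∉ S → heckeT E 2 K 𝔫 lam q w 2 ξ = a w • ξ) :
    IsGrossencharakter (conductorOf (F := K) 𝔫 hS) (fun w => centralExponentAt ι lam w.embedding)
      (fun w => ((w.mult - 1 : ℕ) : ℤ) * centralExponentAt ι lam (ComplexEmbedding.conjugate w.embedding))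
      (fun w => ι (a w)) := by
  haveI : CharZero E := ι.toRingHom.charZero
  exact TwistedQuotient.isGrossencharakter_centralEigensystem_of_types (V := CoeffModule E 2 K lam)
    (diagPos 2 K) (level 2 K 𝔫) (coeffRepPos E 2 K lam) q ι h𝔫 le_rfl hS hξ a heig
    (fun x => zScalar x) (fun x => zScalar_mem_center x) (fun x => diagPos_zScalar x)
    (fun x => centralWeight E 2 K lam x) (fun x v => coeffRepPos_zScalar E lam x v) _ _
    (fun x => map_centralWeight ι lam x)

end Complex

end ResGLnCohomology

end Literature.NumberTheory.Automorphic

end
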